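import Mathlib
import Summits.MatrixMultiplication.MatrixMultiplication.Theorems.SubgroupIdentityDesigns.Negative.FibreGhost
import Summits.MatrixMultiplication.MatrixMultiplication.Theorems.SubgroupIdentityDesigns.Negative.DesignTranslate

/-!
# Level-one functions are combinations of fibre indicators; a design puts every `δ_x`, `x ∈ H₁H₃`, into their span
(negative-side linking lemma for the crux `SubgroupIdentityDesigns`, stmt-MatrixMultiplication-14079; cell B2b-5,
gen 7 — report `run/shared/lean/b2b/levelgraded-cu/ORACLE-g7.md` §G7-1, filters FR / FL)

`fourierMat c = Σ_M c(M) ψ(tr(M ·))` with `c` supported on rank `≤ 1` matrices is a `ℂ`-combination of the FIBRE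
INDICATORS `s ↦ [s a = w]` (`fourierMat_mem_span_fibre`: `M = 0` gives the constant `[s 0 = 0]`, and for `M = a bᵀ`,
`ψ(tr(a bᵀ s)) = ψ(b · s a) = Σ_w ψ(b · w) [s a = w]`).  Combined with `levelOne_design_translate`: if `(H₁,H₂,H₃)`
carries a level-one identity design then for every `a₀ ∈ H₁`, `g₀ ∈ H₃` the delta function of `a₀ g₀` on
`S = H₁H₂H₃` is the restriction to `S` of a function in that span (`single_mem_restrict_span_of_design`).  This is
the hypothesis of `RankSplit.finrank_eq_card_add_finrank_restrict` with `T = H₁H₃`, i.e. the Lean side of the two-rank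
criterion behind the FR and FL census certificates (the remaining steps — indexing the rows by lines and non-zero
`w`, and `rank_GF(2) ≤ rank_ℚ` for a 0/1 matrix — are routine and stay on paper).
Sorry-free.  VALUE = soundness lemma for a certificate format, NOT summit progress.
-/

set_option linter.dupNamespace false

noncomputable section

open scoped BigOperators Classical
open Matrix
open Summit.MatrixMultiplication.MatrixMultiplication.Theorems.LieRankDesigns.Negative (GLm Mat)

namespace Summit.MatrixMultiplication.MatrixMultiplication.Theorems.SubgroupIdentityDesigns.Negative

namespace LevelOneSpan

variable {p : ℕ} [Fact p.Prime]

/-- A level-one function `fourierMat c` (`c` vanishing on rank `> 1`) is a combination of fibre indicators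
`s ↦ [s a = w]`, `(a, w)` ranging over all pairs of vectors. -/
theorem fourierMat_mem_span_fibre (c : CMat p 2 → ℂ) (hc : ∀ M : CMat p 2, 1 < M.rank → c M = 0) :
    (fourierMat c : CMat p 2 → ℂ) ∈ Submodule.span ℂ
      (Set.range fun aw : (Fin 2 → ZMod p) × (Fin 2 → ZMod p) =>
        fun s : CMat p 2 => if s.mulVec aw.1 = aw.2 then (1 : ℂ) else 0) := by
  have hf : (fourierMat c : CMat p 2 → ℂ) =
      ∑ M : CMat p 2, c M • fun s : CMat p 2 => (ZMod.stdAddChar (Matrix.trace (M * s)) : ℂ) := by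
    funext s
    simp [fourierMat, Finset.sum_apply, Pi.smul_apply, smul_eq_mul]
  rw [hf]
  refine Submodule.sum_mem _ fun M _ => ?_
  by_cases hcM : c M = 0
  · simp [hcM]
  · have hM : M.rank ≤ 1 := by
      by_contra h
      exact hcM (hc M (by omega))
    refine Submodule.smul_mem _ _ ?_
    by_cases hM0 : M = 0
    · subst hM0
      have h0 : (fun s : CMat p 2 => (ZMod.stdAddChar (Matrix.trace ((0 : CMat p 2) * s)) : ℂ)) =
          fun s : CMat p 2 => if s.mulVec (0 : Fin 2 → ZMod p) = 0 then (1 : ℂ) else 0 := by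
        funext s
        simp [Matrix.mulVec_zero]
      rw [h0]
      exact Submodule.subset_span ⟨((0 : Fin 2 → ZMod p), (0 : Fin 2 → ZMod p)), rfl⟩
    · obtain ⟨a, b, _, rfl⟩ := exists_vecMulVec_of_rank_le_one M hM hM0
      have h1 : (fun s : CMat p 2 => (ZMod.stdAddChar (Matrix.trace (Matrix.vecMulVec a b * s)) : ℂ)) =
          ∑ x : Fin 2 → ZMod p, (ZMod.stdAddChar (b ⬝ᵥ x) : ℂ) •
            fun s : CMat p 2 => if s.mulVec a = x then (1 : ℂ) else 0 := by
        funext s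
        simp only [trace_vecMulVec_mul, Finset.sum_apply, Pi.smul_apply, smul_eq_mul, mul_ite, mul_one,
          mul_zero]
        rw [Finset.sum_ite_eq]
        simp
      rw [h1]
      exact Submodule.sum_mem _ fun x _ =>
        Submodule.smul_mem _ _ (Submodule.subset_span ⟨(a, x), rfl⟩)

/-- **DESIGNS PUT THE DELTAS OF `H₁H₃` INTO THE LEVEL-ONE SPAN ON `S`.**  If `c` is a level-one identity design for
`(H₁,H₂,H₃)` then for all `a₀ ∈ H₁`, `g₀ ∈ H₃` there is a function in the span of the fibre indicators whose
restriction to `S = H₁H₂H₃` is the delta function of `a₀ g₀`. -/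
theorem single_mem_restrict_span_of_design {H₁ H₂ H₃ : Subgroup (GLm p 2)} (c : Mat p 2 → ℂ)
    (hc : ∀ M : Mat p 2, 1 < M.rank → c M = 0) (h1 : fourierMat c 1 = 1)
    (h0 : ∀ a ∈ H₁, ∀ b ∈ H₂, ∀ g ∈ H₃, a * b * g ≠ 1 → fourierMat c ((a * b * g : GLm p 2) : Mat p 2) = 0)
    {a₀ g₀ : GLm p 2} (ha₀ : a₀ ∈ H₁) (hg₀ : g₀ ∈ H₃) :
    ∃ F : CMat p 2 → ℂ, F ∈ Submodule.span ℂ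
        (Set.range fun aw : (Fin 2 → ZMod p) × (Fin 2 → ZMod p) =>
          fun s : CMat p 2 => if s.mulVec aw.1 = aw.2 then (1 : ℂ) else 0) ∧
      ∀ a ∈ H₁, ∀ b ∈ H₂, ∀ g ∈ H₃,
        F ((a * b * g : GLm p 2) : Mat p 2) = if a * b * g = a₀ * g₀ then 1 else 0 := by
  obtain ⟨hc', h1', h0'⟩ := levelOne_design_translate c hc h1 h0 ha₀ hg₀
  refine ⟨fourierMat fun M => c ((g₀ : Mat p 2) * M * (a₀ : Mat p 2)),
    fourierMat_mem_span_fibre _ hc', ?_⟩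
  intro a ha b hb g hg
  by_cases h : a * b * g = a₀ * g₀
  · rw [if_pos h, h]
    exact h1'
  · rw [if_neg h]
    exact h0' a ha b hb g hg h

end LevelOneSpan

end Summit.MatrixMultiplication.MatrixMultiplication.Theorems.SubgroupIdentityDesigns.Negative
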